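import Mathlib.Analysis.SpecialFunctions.SmoothTransition
import Literature.MathematicalPhysics.QuantumLattice.SchwartzPartition
import Literature.MathematicalPhysics.AQFT.OSAxiomsSchwinger
import HarnessLib

/-!
# Multipliers with bounded derivatives on Schwartz space: uniform and tail bounds

Trunk **T-AQFT** (support file for the half-space cutoffs `SchwartzHalfSpaceCutoff`,
`SchwartzHalfSpaceCutoffB/C` and the clustering / two-orbit synchronisation step of the continuum
limit on a trajectory), families `constructive-qft`, `yang-mills`.

Generic estimates for the multiplication `ψ • f` of a Schwartz function `f ∈ 𝓢(V, F)` by a smooth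
`ψ : V → 𝕜` whose derivatives are bounded, `‖Dⁱ ψ‖_∞ ≤ Aᵢ`:

* `seminorm_smulLeftCLM_le_of_bounds`: `‖ψ f‖_{k,l} ≤ (∑_{i ≤ l} C(l,i) Aᵢ) sup_{≤ (k,l)} ‖f‖`, with a
  constant depending on `ψ` only through `A` (Leibniz, `norm_iteratedFDeriv_smul_le`);
* `seminorm_smulLeftCLM_le_of_bounds_of_eq_zero`: if moreover `ψ = 0` on the open ball of radius
  `R > 0`, then `‖ψ f‖_{k,l} ≤ (∑ C(l,i) Aᵢ) R^{-N} sup_{≤ (k+N,l)} ‖f‖` for every `N`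
  (`‖x‖^k ≤ R^{-N} ‖x‖^{k+N}` off the ball) — the quantitative heart of "`C_c^∞` is dense in `𝒮`";
* `exists_bound_iteratedFDeriv_prod_smoothTransition`: products `∏ⱼ σ(Lⱼ x + cⱼ)` of shifted smooth
  steps `σ = Real.smoothTransition` along linear forms `‖Lⱼ‖ ≤ 1` have derivatives bounded
  independently of the forms and the shifts;
* `isOffDiagonal_smulLeftCLM`: multiplication by a temperate `ψ` preserves `⁰𝒮` (vanishing to
  infinite order on the coincidence locus, `Literature.MathematicalPhysics.AQFT.IsOffDiagonal`);
* `exists_bound_schwartzNorm_of_seminorm_le`: passage from `(k,l)`-seminorm bounds to bounds in the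
  tree's Schwartz norms `schwartzNorm M` (`SchwingerOSAxioms`); `schwartzNorm_translateMulti_le`:
  `|F(· - a, …, · - a)|_M ≤ (2(1 + ‖a‖))^M |F|_M`.

## Sources

Textbook folklore: L. Hörmander, *The Analysis of Linear Partial Differential Operators I*, §7.1
(Lemma 7.1.8 and the continuity of multipliers on `𝒮`); K. Osterwalder, R. Schrader, *Axioms for
Euclidean Green's functions*, CMP 31 (1973), §2. The proofs are self-contained on top of Mathlib.

## Mathlib and Literature

Used from Mathlib: `norm_iteratedFDeriv_smul_le`, `SchwartzMap.seminorm_le_bound`,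
`SchwartzMap.le_seminorm`, `SchwartzMap.smulLeftCLM_apply`, `ContinuousLinearMap.iteratedFDeriv_comp_right`,
`iteratedFDeriv_comp_add_right`, `iteratedFDeriv_sub_apply`. From the tree (`SchwartzPartition`):
`exists_bound_iteratedFDeriv_smoothTransition`, `exists_bound_iteratedFDeriv_prod`,
`hasTemperateGrowth_of_bounds`, `contDiff_ofReal_comp`, `norm_iteratedFDeriv_ofReal_comp`,
`seminorm_compSubConstCLM_le`, `schwartzSeminorm_le_sup_Iic`, `sup_Iic_schwartzSeminorm_mono`;
`translateMulti` (`EuclideanAction`), `schwartzNorm` (`SchwingerOSAxioms`), `IsOffDiagonal`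
(`AQFT.OSAxiomsSchwinger`). Searched and absent at the pin: seminorm bounds for `smulLeftCLM` that are
uniform in the multiplier, tail bounds with a polynomial gain.
-/

set_option autoImplicit false

open scoped SchwartzMap Topology ContDiff
open Filter Set

noncomputable section

namespace Literature.MathematicalPhysics.QuantumLattice

/-! ### Weighted Leibniz bounds on Schwartz space -/

section General

variable {V : Type*} [NormedAddCommGroup V] [NormedSpace ℝ V]

/-- Precomposition with a continuous linear map of norm `≤ 1` does not increase the norm of the
iterated derivative: `‖Dⁱ(g ∘ L) x‖ ≤ ‖Dⁱ g (L x)‖` (Hörmander, ALPDO I §7.1; Osterwalder–Schrader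
1973 §2). [folklore] -/
theorem norm_iteratedFDeriv_comp_right_le_of_norm_le_one {W G : Type*} [NormedAddCommGroup W]
    [NormedSpace ℝ W] [NormedAddCommGroup G] [NormedSpace ℝ G] {g : W → G} (hg : ContDiff ℝ ∞ g)
    (L : V →L[ℝ] W) (hL : ‖L‖ ≤ 1) (i : ℕ) (x : V) :
    ‖iteratedFDeriv ℝ i (g ∘ L) x‖ ≤ ‖iteratedFDeriv ℝ i g (L x)‖ := by
  rw [L.iteratedFDeriv_comp_right hg x (by exact_mod_cast le_top)]
  refine (ContinuousMultilinearMap.norm_compContinuousLinearMap_le _ _).trans ?_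
  refine mul_le_of_le_one_right (norm_nonneg _) ?_
  exact Finset.prod_le_one (fun _ _ => norm_nonneg _) fun _ _ => hL

/-- If `W` has derivatives bounded by `A`, then `1 - W` has derivatives bounded by `A + 1`
(Hörmander, ALPDO I §7.1; Osterwalder–Schrader 1973 §2). [folklore] -/
theorem norm_iteratedFDeriv_one_sub_le {W : V → ℝ} (hW : ContDiff ℝ ∞ W) {A : ℕ → ℝ}
    (hA : ∀ j x, ‖iteratedFDeriv ℝ j W x‖ ≤ A j) (j : ℕ) (x : V) :
    ‖iteratedFDeriv ℝ j (fun y => 1 - W y) x‖ ≤ A j + 1 := by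
  have hsub : (fun y => 1 - W y) = (fun _ => (1 : ℝ)) - W := rfl
  rw [hsub, iteratedFDeriv_sub_apply contDiffAt_const
    (hW.contDiffAt.of_le (by exact_mod_cast le_top))]
  have h1 : ‖iteratedFDeriv ℝ j (fun _ : V => (1 : ℝ)) x‖ ≤ 1 := by
    rcases Nat.eq_zero_or_pos j with rfl | hj
    · rw [norm_iteratedFDeriv_zero]; simp
    · rw [iteratedFDeriv_const_of_ne (Nat.pos_iff_ne_zero.1 hj)]; simp
  have h2 := hA j x
  exact (norm_sub_le _ _).trans (by linarith)

/-- Coercing a smooth real function into `ℂ` keeps it smooth (the `ℂ`-valued form of the tree's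
`contDiff_ofReal_comp`, stated with the coercion `Complex.ofReal`). [folklore] -/
theorem contDiff_complex_ofReal_comp {W : V → ℝ} {n : WithTop ℕ∞} (hW : ContDiff ℝ n W) :
    ContDiff ℝ n fun x => (W x : ℂ) :=
  contDiff_ofReal_comp ℂ hW

/-- Coercing into `ℂ` preserves the norms of all derivatives (the `ℂ`-valued form of the tree's
`norm_iteratedFDeriv_ofReal_comp`). [folklore] -/
theorem norm_iteratedFDeriv_complex_ofReal_comp {W : V → ℝ} (hW : ContDiff ℝ ∞ W) (j : ℕ) (x : V) :
    ‖iteratedFDeriv ℝ j (fun y => (W y : ℂ)) x‖ = ‖iteratedFDeriv ℝ j W x‖ :=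
  norm_iteratedFDeriv_ofReal_comp ℂ hW j x

variable {F : Type*} [NormedAddCommGroup F] [NormedSpace ℝ F]
variable (𝕜 : Type*) [RCLike 𝕜] [NormedSpace 𝕜 F] [SMulCommClass ℝ 𝕜 F]

/-- **Weighted Leibniz bound, pointwise.** For `ψ` of class `C^l` with `‖Dⁱ ψ (x)‖ ≤ Aᵢ` (`i ≤ l`)
and `f ∈ 𝓢(V, F)`: `‖x‖^k ‖D^l(ψ f)(x)‖ ≤ (∑ᵢ C(l,i) Aᵢ) · sup_{(k',l') ≤ (k,l)} ‖f‖_{k',l'}`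
(Hörmander, ALPDO I §7.1; Osterwalder–Schrader 1973 §2). [folklore] -/
theorem pow_mul_norm_iteratedFDeriv_smul_le {ψ : V → 𝕜} {l : ℕ} (hψ : ContDiff ℝ l ψ)
    {A : ℕ → ℝ} {x : V} (hA : ∀ i ≤ l, ‖iteratedFDeriv ℝ i ψ x‖ ≤ A i) (f : 𝓢(V, F)) (k : ℕ) :
    ‖x‖ ^ k * ‖iteratedFDeriv ℝ l (fun y => ψ y • f y) x‖ ≤
      (∑ i ∈ Finset.range (l + 1), (l.choose i : ℝ) * A i) *
        (Finset.Iic (k, l)).sup (schwartzSeminormFamily 𝕜 V F) f := by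
  set S := (Finset.Iic (k, l)).sup (schwartzSeminormFamily 𝕜 V F) f with hS
  have hS0 : 0 ≤ S := apply_nonneg _ _
  have hleib := norm_iteratedFDeriv_smul_le (𝕜 := ℝ) hψ (f.smooth l) x (n := l) le_rfl
  have hterm : ∀ i ∈ Finset.range (l + 1),
      ‖x‖ ^ k * ((l.choose i : ℝ) * ‖iteratedFDeriv ℝ i ψ x‖ *
        ‖iteratedFDeriv ℝ (l - i) f x‖) ≤ (l.choose i : ℝ) * A i * S := by
    intro i hi
    have hil : i ≤ l := Nat.lt_succ_iff.1 (Finset.mem_range.1 hi)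
    have h1 : ‖x‖ ^ k * ‖iteratedFDeriv ℝ (l - i) f x‖ ≤ S :=
      (SchwartzMap.le_seminorm 𝕜 k (l - i) f x).trans
        (schwartzSeminorm_le_sup_Iic 𝕜 le_rfl (Nat.sub_le l i) f)
    have hA0 : 0 ≤ A i := (norm_nonneg _).trans (hA i hil)
    calc ‖x‖ ^ k * ((l.choose i : ℝ) * ‖iteratedFDeriv ℝ i ψ x‖ * ‖iteratedFDeriv ℝ (l - i) f x‖)
        = (l.choose i : ℝ) * ‖iteratedFDeriv ℝ i ψ x‖ *
            (‖x‖ ^ k * ‖iteratedFDeriv ℝ (l - i) f x‖) := by ring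
      _ ≤ (l.choose i : ℝ) * A i * S :=
          mul_le_mul (mul_le_mul_of_nonneg_left (hA i hil) (Nat.cast_nonneg _)) h1
            (by positivity) (mul_nonneg (Nat.cast_nonneg _) hA0)
  calc ‖x‖ ^ k * ‖iteratedFDeriv ℝ l (fun y => ψ y • f y) x‖
      ≤ ‖x‖ ^ k * ∑ i ∈ Finset.range (l + 1), (l.choose i : ℝ) * ‖iteratedFDeriv ℝ i ψ x‖ *
          ‖iteratedFDeriv ℝ (l - i) f x‖ := by gcongr
    _ = ∑ i ∈ Finset.range (l + 1), ‖x‖ ^ k * ((l.choose i : ℝ) * ‖iteratedFDeriv ℝ i ψ x‖ *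
          ‖iteratedFDeriv ℝ (l - i) f x‖) := by rw [Finset.mul_sum]
    _ ≤ ∑ i ∈ Finset.range (l + 1), (l.choose i : ℝ) * A i * S := Finset.sum_le_sum hterm
    _ = (∑ i ∈ Finset.range (l + 1), (l.choose i : ℝ) * A i) * S := by rw [Finset.sum_mul]

/-- **Weighted Leibniz bound with a polynomial gain, pointwise.** Under the hypotheses of
`pow_mul_norm_iteratedFDeriv_smul_le`, at a point with `‖x‖ ≥ R > 0`:
`‖x‖^k ‖D^l(ψ f)(x)‖ ≤ (∑ᵢ C(l,i) Aᵢ) · R^{-N} · sup_{(k',l') ≤ (k+N,l)} ‖f‖_{k',l'}`, since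
`‖x‖^k ≤ R^{-N} ‖x‖^{k+N}` (Hörmander, ALPDO I §7.1; Osterwalder–Schrader 1973 §2). [folklore] -/
theorem pow_mul_norm_iteratedFDeriv_smul_le_inv_pow {ψ : V → 𝕜} {l : ℕ} (hψ : ContDiff ℝ l ψ)
    {A : ℕ → ℝ} {x : V} (hA : ∀ i ≤ l, ‖iteratedFDeriv ℝ i ψ x‖ ≤ A i) (f : 𝓢(V, F)) (k N : ℕ)
    {R : ℝ} (hR : 0 < R) (hx : R ≤ ‖x‖) :
    ‖x‖ ^ k * ‖iteratedFDeriv ℝ l (fun y => ψ y • f y) x‖ ≤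
      (∑ i ∈ Finset.range (l + 1), (l.choose i : ℝ) * A i) * R⁻¹ ^ N *
        (Finset.Iic (k + N, l)).sup (schwartzSeminormFamily 𝕜 V F) f := by
  have h := pow_mul_norm_iteratedFDeriv_smul_le 𝕜 hψ hA f (k + N)
  set D := ‖iteratedFDeriv ℝ l (fun y => ψ y • f y) x‖ with hD
  set M := ∑ i ∈ Finset.range (l + 1), (l.choose i : ℝ) * A i with hM
  set S := (Finset.Iic (k + N, l)).sup (schwartzSeminormFamily 𝕜 V F) f with hS
  have hxpos : 0 < ‖x‖ := hR.trans_le hx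
  have hxN : 0 < ‖x‖ ^ N := pow_pos hxpos N
  have hMS : 0 ≤ M * S := le_trans (by positivity) h
  calc ‖x‖ ^ k * D = (‖x‖ ^ (k + N) * D) / ‖x‖ ^ N := by
        rw [pow_add]; field_simp
    _ ≤ M * S / ‖x‖ ^ N := div_le_div_of_nonneg_right h hxN.le
    _ ≤ M * S / R ^ N := div_le_div_of_nonneg_left hMS (pow_pos hR N) (pow_le_pow_left₀ hR.le hx N)
    _ = M * R⁻¹ ^ N * S := by rw [inv_pow]; ring

/-- **Multiplication by a function with bounded derivatives is bounded on `𝓢`, quantitatively.**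
If `ψ : V → 𝕜` is smooth with `‖Dⁱ ψ‖_∞ ≤ Aᵢ` for all `i`, then for every `f ∈ 𝓢(V, F)`,
`‖ψ f‖_{k,l} ≤ (∑_{i ≤ l} C(l,i) Aᵢ) · sup_{(k',l') ≤ (k,l)} ‖f‖_{k',l'}`; the constant depends on
`ψ` only through the bounds `A` (Hörmander, ALPDO I §7.1; Osterwalder–Schrader 1973 §2). [folklore] -/
theorem seminorm_smulLeftCLM_le_of_bounds {ψ : V → 𝕜} (hψ : ContDiff ℝ ∞ ψ) {A : ℕ → ℝ}
    (hA : ∀ i x, ‖iteratedFDeriv ℝ i ψ x‖ ≤ A i) (k l : ℕ) (f : 𝓢(V, F)) :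
    SchwartzMap.seminorm 𝕜 k l (SchwartzMap.smulLeftCLM F ψ f) ≤
      (∑ i ∈ Finset.range (l + 1), (l.choose i : ℝ) * A i) *
        (Finset.Iic (k, l)).sup (schwartzSeminormFamily 𝕜 V F) f := by
  have hA0 : ∀ i, 0 ≤ A i := fun i => (norm_nonneg _).trans (hA i 0)
  have hψt : ψ.HasTemperateGrowth := hasTemperateGrowth_of_bounds hψ A hA
  have hM0 : 0 ≤ ∑ i ∈ Finset.range (l + 1), (l.choose i : ℝ) * A i :=
    Finset.sum_nonneg fun i _ => mul_nonneg (Nat.cast_nonneg _) (hA0 i)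
  refine SchwartzMap.seminorm_le_bound 𝕜 k l _ (mul_nonneg hM0 (apply_nonneg _ _)) fun x => ?_
  rw [SchwartzMap.smulLeftCLM_apply hψt]
  exact pow_mul_norm_iteratedFDeriv_smul_le 𝕜 (hψ.of_le (by exact_mod_cast le_top))
    (fun i _ => hA i x) f k

/-- **Tail bound.** If moreover `ψ` vanishes on the open ball of radius `R > 0`, then `ψ f` only
sees `f` where `‖x‖ ≥ R`, and one gains any power of `R`:
`‖ψ f‖_{k,l} ≤ (∑_{i ≤ l} C(l,i) Aᵢ) · R^{-N} · sup_{(k',l') ≤ (k+N,l)} ‖f‖_{k',l'}`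
(Hörmander, ALPDO I §7.1, proof of Lemma 7.1.8; Osterwalder–Schrader 1973 §2). [folklore] -/
theorem seminorm_smulLeftCLM_le_of_bounds_of_eq_zero {ψ : V → 𝕜} (hψ : ContDiff ℝ ∞ ψ)
    {A : ℕ → ℝ} (hA : ∀ i x, ‖iteratedFDeriv ℝ i ψ x‖ ≤ A i) {R : ℝ} (hR : 0 < R)
    (h0 : ∀ x, ‖x‖ < R → ψ x = 0) (k l N : ℕ) (f : 𝓢(V, F)) :
    SchwartzMap.seminorm 𝕜 k l (SchwartzMap.smulLeftCLM F ψ f) ≤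
      (∑ i ∈ Finset.range (l + 1), (l.choose i : ℝ) * A i) * R⁻¹ ^ N *
        (Finset.Iic (k + N, l)).sup (schwartzSeminormFamily 𝕜 V F) f := by
  have hA0 : ∀ i, 0 ≤ A i := fun i => (norm_nonneg _).trans (hA i 0)
  have hψt : ψ.HasTemperateGrowth := hasTemperateGrowth_of_bounds hψ A hA
  have hM0 : 0 ≤ ∑ i ∈ Finset.range (l + 1), (l.choose i : ℝ) * A i :=
    Finset.sum_nonneg fun i _ => mul_nonneg (Nat.cast_nonneg _) (hA0 i)
  have hC0 : 0 ≤ (∑ i ∈ Finset.range (l + 1), (l.choose i : ℝ) * A i) * R⁻¹ ^ N *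
      (Finset.Iic (k + N, l)).sup (schwartzSeminormFamily 𝕜 V F) f :=
    mul_nonneg (mul_nonneg hM0 (pow_nonneg (inv_nonneg.2 hR.le) N)) (apply_nonneg _ _)
  refine SchwartzMap.seminorm_le_bound 𝕜 k l _ hC0 fun x => ?_
  rw [SchwartzMap.smulLeftCLM_apply hψt]
  by_cases hx : ‖x‖ < R
  · -- inside the ball `ψ f` vanishes identically near `x`
    have hsupp : Function.support (fun y => ψ y • f y) ⊆ (Metric.ball (0 : V) R)ᶜ := by
      intro y hy
      rw [mem_compl_iff, mem_ball_zero_iff]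
      intro hyR
      exact hy (by simp [h0 y hyR])
    have hx' : x ∉ tsupport (fun y => ψ y • f y) := fun h =>
      (closure_minimal hsupp Metric.isOpen_ball.isClosed_compl h) (mem_ball_zero_iff.2 hx)
    have h0' : iteratedFDeriv ℝ l (fun y => ψ y • f y) x = 0 :=
      Function.notMem_support.1 fun h => hx' (support_iteratedFDeriv_subset l h)
    rw [h0', norm_zero, mul_zero]
    exact hC0
  · exact pow_mul_norm_iteratedFDeriv_smul_le_inv_pow 𝕜 (hψ.of_le (by exact_mod_cast le_top))
      (fun i _ => hA i x) f k N hR (not_lt.1 hx)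

/-- **Uniform derivative bounds for products of shifted smooth steps along linear forms.** For each
order `i` there is `C` (depending on `i` and the number of factors `p` only) with
`‖Dⁱ (x ↦ ∏ⱼ σ(Lⱼ x + cⱼ))‖ ≤ C` for all linear forms `‖Lⱼ‖ ≤ 1` and all shifts `cⱼ`,
`σ = Real.smoothTransition` (Hörmander, ALPDO I §7.1; Osterwalder–Schrader 1973 §2). [folklore] -/
theorem exists_bound_iteratedFDeriv_prod_smoothTransition (p i : ℕ) :
    ∃ C : ℝ, ∀ (L : Fin p → V →L[ℝ] ℝ), (∀ j, ‖L j‖ ≤ 1) → ∀ (c : Fin p → ℝ) (x : V),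
      ‖iteratedFDeriv ℝ i (fun x => ∏ j, Real.smoothTransition (L j x + c j)) x‖ ≤ C := by
  have hB := fun n => exists_bound_iteratedFDeriv_smoothTransition n
  choose B hB using hB
  obtain ⟨A', hA'⟩ := exists_bound_iteratedFDeriv_prod (X := V) (ι' := Fin p) B p
  refine ⟨A' i, fun L hL c x => ?_⟩
  have hsm : ∀ j, ContDiff ℝ ∞ (fun x => Real.smoothTransition (L j x + c j)) := fun j =>
    Real.smoothTransition.contDiff.comp ((L j).contDiff.add contDiff_const)
  have hfac : ∀ j n y, ‖iteratedFDeriv ℝ n (fun x => Real.smoothTransition (L j x + c j)) y‖ ≤ B n := by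
    intro j n y
    have hcomp : (fun x => Real.smoothTransition (L j x + c j)) =
        (fun t => Real.smoothTransition (t + c j)) ∘ (L j) := rfl
    have hg : ContDiff ℝ ∞ (fun t : ℝ => Real.smoothTransition (t + c j)) :=
      Real.smoothTransition.contDiff.comp (contDiff_id.add contDiff_const)
    rw [hcomp]
    refine (norm_iteratedFDeriv_comp_right_le_of_norm_le_one hg (L j) (hL j) n y).trans ?_
    rw [iteratedFDeriv_comp_add_right]
    exact hB n _
  exact hA' Finset.univ (by simp) (fun j x => Real.smoothTransition (L j x + c j))
    (fun j _ => hsm j) (fun j _ n y => hfac j n y) i x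

end General

/-! ### Off-diagonality is preserved by smooth multipliers -/

section OffDiagonal

open Literature.MathematicalPhysics.AQFT

variable {E : Type*} [NormedAddCommGroup E] [NormedSpace ℝ E] {n : ℕ}

/-- **`⁰𝒮` is a module over temperate smooth functions**: if `F` vanishes to infinite order on the
coincidence locus, so does `ψ F` for every `ψ` of temperate growth (Leibniz: every term of
`D^k(ψ F)(x)` contains a derivative of `F` at `x`) (Osterwalder–Schrader 1973 §2; Hörmander,
ALPDO I §7.1). [folklore] -/
theorem isOffDiagonal_smulLeftCLM {ψ : (Fin n → E) → ℂ} (hψ : ψ.HasTemperateGrowth)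
    {F : 𝓢((Fin n → E), ℂ)} (hF : IsOffDiagonal F) :
    IsOffDiagonal (SchwartzMap.smulLeftCLM ℂ ψ F) := by
  intro x hx k
  rw [SchwartzMap.smulLeftCLM_apply hψ]
  have h := norm_iteratedFDeriv_smul_le (𝕜 := ℝ) (hψ.1.of_le (by exact_mod_cast le_top))
    (F.smooth k) x (n := k) le_rfl
  have h0 : ∑ i ∈ Finset.range (k + 1), (k.choose i : ℝ) * ‖iteratedFDeriv ℝ i ψ x‖ *
      ‖iteratedFDeriv ℝ (k - i) F x‖ = 0 :=
    Finset.sum_eq_zero fun i _ => by rw [hF x hx (k - i), norm_zero, mul_zero]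
  exact norm_le_zero_iff.1 (h.trans_eq h0)

end OffDiagonal

/-! ### Schwartz norms: aggregation and translates -/

section SchwartzNormAgg

variable {X : Type*} [NormedAddCommGroup X] [NormedSpace ℝ X]

/-- **From seminorm bounds to Schwartz-norm bounds.** If a family of maps `T a` satisfies, for all
`k, l`, `‖T a F‖_{k,l} ≤ C_{k,l} ρ(a) sup_{≤ (k+N,l)} ‖F‖` (for the parameters `a` with `P a`), then
`|T a F|_M ≤ C ρ(a) |F|_{M+N}` in the tree's Schwartz norms `schwartzNorm` (finite maximum over
`Finset.Iic (M, M)`) (Osterwalder–Schrader 1973 §2; Hörmander, ALPDO I §7.1). [folklore] -/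
theorem exists_bound_schwartzNorm_of_seminorm_le {α : Type*} (T : α → 𝓢(X, ℂ) → 𝓢(X, ℂ))
    (P : α → Prop) (ρ : α → ℝ) (hρ : ∀ a, P a → 0 ≤ ρ a) (N : ℕ)
    (h : ∀ k l : ℕ, ∃ C : ℝ, 0 ≤ C ∧ ∀ a, P a → ∀ F : 𝓢(X, ℂ),
      SchwartzMap.seminorm ℂ k l (T a F) ≤
        C * ρ a * (Finset.Iic (k + N, l)).sup (schwartzSeminormFamily ℂ X ℂ) F) (M : ℕ) :
    ∃ C : ℝ, 0 ≤ C ∧ ∀ a, P a → ∀ F : 𝓢(X, ℂ),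
      schwartzNorm M (T a F) ≤ C * ρ a * schwartzNorm (M + N) F := by
  have h' := fun i : ℕ × ℕ => h i.1 i.2
  choose C hC0 hC using h'
  refine ⟨∑ i ∈ Finset.Iic (M, M), C i, Finset.sum_nonneg fun i _ => hC0 i, fun a ha F => ?_⟩
  have hS0 : 0 ≤ schwartzNorm (M + N) F := schwartzNorm_nonneg _ _
  unfold schwartzNorm
  refine Seminorm.finset_sup_apply_le (mul_nonneg (mul_nonneg (Finset.sum_nonneg fun i _ => hC0 i)
    (hρ a ha)) (apply_nonneg _ _)) fun i hi => ?_
  obtain ⟨hi1, hi2⟩ := Prod.mk_le_mk.1 (Finset.mem_Iic.1 hi)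
  rw [SchwartzMap.schwartzSeminormFamily_apply]
  refine (hC i a ha F).trans ?_
  have hsup : (Finset.Iic (i.1 + N, i.2)).sup (schwartzSeminormFamily ℂ X ℂ) F ≤
      (Finset.Iic (M + N, M + N)).sup (schwartzSeminormFamily ℂ X ℂ) F :=
    sup_Iic_schwartzSeminorm_mono ℂ (by omega) (by omega) F
  calc C i * ρ a * (Finset.Iic (i.1 + N, i.2)).sup (schwartzSeminormFamily ℂ X ℂ) F
      ≤ C i * ρ a * (Finset.Iic (M + N, M + N)).sup (schwartzSeminormFamily ℂ X ℂ) F :=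
        mul_le_mul_of_nonneg_left hsup (mul_nonneg (hC0 i) (hρ a ha))
    _ ≤ (∑ j ∈ Finset.Iic (M, M), C j) * ρ a *
          (Finset.Iic (M + N, M + N)).sup (schwartzSeminormFamily ℂ X ℂ) F :=
        mul_le_mul_of_nonneg_right (mul_le_mul_of_nonneg_right
          (Finset.single_le_sum (fun j _ => hC0 j) hi) (hρ a ha)) (apply_nonneg _ _)

/-- **From uniform seminorm bounds to uniform Schwartz-norm bounds**: if `‖T a F‖_{k,l} ≤ C_{k,l}
sup_{≤ (k,l)} ‖F‖` for all `a`, then `|T a F|_M ≤ C |F|_M` for all `a` (Osterwalder–Schrader 1973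
§2; Hörmander, ALPDO I §7.1). [folklore] -/
theorem exists_bound_schwartzNorm_of_seminorm_le_uniform {α : Type*} (T : α → 𝓢(X, ℂ) → 𝓢(X, ℂ))
    (h : ∀ k l : ℕ, ∃ C : ℝ, 0 ≤ C ∧ ∀ (a : α) (F : 𝓢(X, ℂ)),
      SchwartzMap.seminorm ℂ k l (T a F) ≤
        C * (Finset.Iic (k, l)).sup (schwartzSeminormFamily ℂ X ℂ) F) (M : ℕ) :
    ∃ C : ℝ, 0 ≤ C ∧ ∀ (a : α) (F : 𝓢(X, ℂ)), schwartzNorm M (T a F) ≤ C * schwartzNorm M F := by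
  have h' : ∀ k l : ℕ, ∃ C : ℝ, 0 ≤ C ∧ ∀ a : α, True → ∀ F : 𝓢(X, ℂ),
      SchwartzMap.seminorm ℂ k l (T a F) ≤
        C * 1 * (Finset.Iic (k + 0, l)).sup (schwartzSeminormFamily ℂ X ℂ) F := by
    intro k l
    obtain ⟨C, hC0, hC⟩ := h k l
    exact ⟨C, hC0, fun a _ F => by simpa using hC a F⟩
  obtain ⟨C, hC0, hC⟩ := exists_bound_schwartzNorm_of_seminorm_le T (fun _ => True) (fun _ => (1 : ℝ))
    (fun _ _ => zero_le_one) 0 h' M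
  exact ⟨C, hC0, fun a F => by simpa using hC a trivial F⟩

variable {E : Type*} [NormedAddCommGroup E] [NormedSpace ℝ E] {n : ℕ}

/-- **Schwartz norms of diagonal translates grow polynomially**:
`|F(· - a, …, · - a)|_M ≤ (2(1 + ‖a‖))^M |F|_M` (`seminorm_compSubConstCLM_le` at the constant
vector, whose sup norm is `≤ ‖a‖`) (Osterwalder–Schrader 1973 §2; Hörmander, ALPDO I §7.1). [folklore] -/
theorem schwartzNorm_translateMulti_le (M : ℕ) (a : E) (F : 𝓢((Fin n → E), ℂ)) :
    schwartzNorm M (translateMulti a F) ≤ (2 * (1 + ‖a‖)) ^ M * schwartzNorm M F := by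
  have ha : ‖(fun _ : Fin n => a)‖ ≤ ‖a‖ := pi_norm_const_le a
  have h1 : (1 : ℝ) ≤ 2 * (1 + ‖a‖) := by nlinarith [norm_nonneg a]
  unfold schwartzNorm
  refine Seminorm.finset_sup_apply_le (mul_nonneg (by positivity) (apply_nonneg _ _)) fun i hi => ?_
  obtain ⟨hk, hl⟩ := Prod.mk_le_mk.1 (Finset.mem_Iic.1 hi)
  rw [SchwartzMap.schwartzSeminormFamily_apply]
  refine (seminorm_compSubConstCLM_le ℂ i.1 i.2 (fun _ : Fin n => a) F).trans ?_
  have h2 : (2 * (1 + ‖fun _ : Fin n => a‖)) ^ i.1 ≤ (2 * (1 + ‖a‖)) ^ M :=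
    (pow_le_pow_left₀ (by positivity) (by linarith) _).trans (pow_le_pow_right₀ h1 hk)
  exact mul_le_mul h2 (sup_Iic_schwartzSeminorm_mono ℂ hk hl F) (apply_nonneg _ _) (by positivity)

end SchwartzNormAgg

end Literature.MathematicalPhysics.QuantumLattice
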